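import Mathlib
import Summits.ResolutionOfSingularities.ResolutionOfSingularities.Theorems.WildQuotientsWildQuotientResolutionCyclicTransferAlgebra
import Literature.AlgebraicGeometry.Resolution.FiniteQuotientSingularityPresentation

/-!
# Király–Lütkebohmert terminal state ⟹ the fixed-point subalgebra is regular (chart adapter)
(crux stmt-ResolutionOfSingularities-15640 `WildQuotients.WildQuotientResolution`, line `Sketch`,
registered stub `isRegularRing_fixedPoints_zpowers` of lead res-L1-w45c-lead-1)

[OURS · L1 W4.5c] The `k`-algebra form of `CyclicTransfer.isRegularRing_eqLocus` used by the tame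
transfer's charts: for a `k`-algebra automorphism `σ` of prime order `p` of a regular domain `U` of
finite type over `k`, in the Király–Lütkebohmert terminal state (augmentation ideal principal at
every `σ`-fixed prime), the invariant subalgebra `FixedPoints.subalgebra k U (Subgroup.zpowers σ)`
is a regular ring. NOT a statement of the manuscript.
-/

set_option linter.dupNamespace false

noncomputable section

namespace Summit.ResolutionOfSingularities.ResolutionOfSingularities.Theorems.WildQuotientResolution.TameTransfer

/-- The fixed-point subalgebra of the cyclic group `⟨σ⟩` generated by a `k`-algebra automorphism
`σ` has the same elements as the fixed subring `eqLocus σ id` of `σ`. [folklore] -/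
theorem mem_fixedPoints_zpowers_iff {k U : Type} [Field k] [CommRing U] [Algebra k U]
    (σ : U ≃ₐ[k] U) (u : U) :
    u ∈ FixedPoints.subalgebra k U (Subgroup.zpowers σ) ↔
      u ∈ ((σ : U ≃+* U) : U →+* U).eqLocus (RingHom.id U) := by
  rw [RingHom.mem_eqLocus, RingHom.id_apply]
  change (∀ g : Subgroup.zpowers σ, g • u = u) ↔ σ u = u
  constructor
  · intro h
    exact h ⟨σ, Subgroup.mem_zpowers σ⟩
  · intro h g
    have hst : (g : U ≃ₐ[k] U) ∈ MulAction.stabilizer (U ≃ₐ[k] U) u :=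
      (Subgroup.zpowers_le.mpr (MulAction.mem_stabilizer_iff.mpr h)) g.2
    exact MulAction.mem_stabilizer_iff.mp hst

/-- **Registered stub `isRegularRing_fixedPoints_zpowers`** (classical adapter): for a `k`-algebra
automorphism `σ ≠ 1`, `σ ^ p = 1` (`p` prime) of a regular domain `U` of finite type over the
field `k` such that at every `σ`-fixed prime `𝔮` the augmentation ideal `(σ u - u : u)` becomes
principal in `U_𝔮`, the invariant subalgebra `U^⟨σ⟩ = FixedPoints.subalgebra k U (zpowers σ)` is
a regular ring: it has the same elements as `eqLocus σ id` (`mem_fixedPoints_zpowers_iff`), it is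
Noetherian as a finite-type `k`-algebra (E. Noether, `isNoetherianRing_fixedPointsSubalgebra`),
and `eqLocus σ id` is regular by `CyclicTransfer.isRegularRing_eqLocus`; transport along the
tautological ring isomorphism. [cite: KiralyLutkebohmert2013, Thm 2] -/
theorem isRegularRing_fixedPoints_zpowers {k U : Type} [Field k] [CommRing U] [IsDomain U]
    [IsRegularRing U] [Algebra k U] [Algebra.FiniteType k U] {p : ℕ} (hp : p.Prime)
    (σ : U ≃ₐ[k] U) (hσ1 : σ ≠ 1) (hσp : σ ^ p = 1)
    (hdiv : ∀ (𝔮 : Ideal U) [𝔮.IsPrime], 𝔮.comap σ = 𝔮 →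
      ((Ideal.span (Set.range fun u : U => σ u - u)).map
        (algebraMap U (Localization.AtPrime 𝔮))).IsPrincipal) :
    IsRegularRing (FixedPoints.subalgebra k U (Subgroup.zpowers σ)) := by
  classical
  -- the underlying ring automorphism and its order
  set τ : U ≃+* U := (σ : U ≃+* U) with hτ
  have hτ_apply : ∀ u : U, τ u = σ u := fun u => rfl
  have hτ_pow : ∀ (n : ℕ) (u : U), (τ ^ n) u = (σ ^ n) u := by
    intro n
    induction n with
    | zero => intro u; rfl
    | succ n ih =>
      intro u
      rw [pow_succ, pow_succ, RingAut.mul_apply, AlgEquiv.mul_apply, hτ_apply, ih]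
  have hτ1 : τ ≠ RingEquiv.refl U := by
    intro h
    apply hσ1
    ext u
    have := hτ_apply u
    rw [h, RingEquiv.refl_apply] at this
    exact this.symm
  have hτp : τ ^ p = RingEquiv.refl U := by
    ext u
    rw [hτ_pow, hσp, AlgEquiv.one_apply, RingEquiv.refl_apply]
  -- `⟨σ⟩` is finite, so the fixed-point subalgebra is Noetherian (E. Noether)
  have hfin : IsOfFinOrder σ := isOfFinOrder_iff_pow_eq_one.mpr ⟨p, hp.pos, hσp⟩
  haveI : Finite (Subgroup.zpowers σ) := Set.finite_coe_iff.mpr hfin.finite_zpowers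
  haveI : IsNoetherianRing (FixedPoints.subalgebra k U (Subgroup.zpowers σ)) :=
    Literature.AlgebraicGeometry.Resolution.isNoetherianRing_fixedPointsSubalgebra k U
      (Subgroup.zpowers σ)
  -- the tautological isomorphism with `eqLocus τ id`
  let e : FixedPoints.subalgebra k U (Subgroup.zpowers σ) ≃+* (τ : U →+* U).eqLocus (RingHom.id U) :=
    { toFun := fun x => ⟨x.1, (mem_fixedPoints_zpowers_iff σ x.1).mp x.2⟩
      invFun := fun x => ⟨x.1, (mem_fixedPoints_zpowers_iff σ x.1).mpr x.2⟩
      left_inv := fun _ => rfl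
      right_inv := fun _ => rfl
      map_mul' := fun _ _ => rfl
      map_add' := fun _ _ => rfl }
  haveI : IsNoetherianRing ((τ : U →+* U).eqLocus (RingHom.id U)) :=
    isNoetherianRing_of_ringEquiv _ e
  -- the localised divisorial hypothesis, restated for `τ`
  have hdiv' : ∀ (𝔮 : Ideal U) [𝔮.IsPrime], 𝔮.comap τ = 𝔮 →
      ((Ideal.span (Set.range fun u : U => τ u - u)).map
        (algebraMap U (Localization.AtPrime 𝔮))).IsPrincipal := by
    intro 𝔮 _ h𝔮
    have h𝔮' : 𝔮.comap σ = 𝔮 := by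
      refine Eq.trans ?_ h𝔮
      ext u
      rw [Ideal.mem_comap, Ideal.mem_comap, hτ_apply]
    exact hdiv 𝔮 h𝔮'
  haveI : IsRegularRing ((τ : U →+* U).eqLocus (RingHom.id U)) :=
    CyclicTransfer.isRegularRing_eqLocus hp τ hτ1 hτp hdiv'
  exact IsRegularRing.of_ringEquiv e.symm

end Summit.ResolutionOfSingularities.ResolutionOfSingularities.Theorems.WildQuotientResolution.TameTransfer

end
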